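import Mathlib
import Literature.Computability.AlgebraicComplexity.OrbitClosure
import Literature.Computability.AlgebraicComplexity.DeterminantalComplexity
import Literature.Computability.AlgebraicComplexity.EquivariantDC
import Summits.ValiantsHypothesis.ValiantsHypothesis.Theses.BorderApolarity

/-!
# Sketch — first lemmas for the crux-idea cards on `FixedWitnessObstructionQP`
(crux stmt-ValiantsHypothesis-5778, route BorderApolarity). Planner scratch file; nothing here is
filed as an item. Conventions as in the route file: permanent size `n`, determinant size `m`,
padding variable `ℓ = X₀₀`, block `Y = {(i,j) : m-n ≤ i, j}`, the other `m²-n²-1` variables `z`;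
`linSubst M` substitutes `X_i ↦ ∑_j M j i • X_j`.
-/

noncomputable section

open MvPolynomial Literature.Computability.AlgebraicComplexity

namespace Summit.ValiantsHypothesis.ValiantsHypothesis.Cruxes.FixedWitnessObstructionQP.Sketch

/-- `y` is one of the "kept" variables `ℓ, Y` of the padded permanent at `(n,m)`. -/
def IsKept (n m : ℕ) (p : Fin m × Fin m) : Prop :=
  (m - n ≤ (p.1 : ℕ) ∧ m - n ≤ (p.2 : ℕ)) ∨ ((p.1 : ℕ) = 0 ∧ (p.2 : ℕ) = 0)

/-- **Card `internal-borel-zfree-ladder`, first lemma (UFixedIsZFree).** A polynomial fixed by all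
the unipotent elements `X_z ↦ X_z + s·X_y` of `H₀(n,m)` (`y` kept, `z` a padding variable; these
transvections satisfy the four `H₀` clauses of the crux) does not involve any padding variable.
Hence every `H₀`-eigenvector inside a fixed witness is `z`-free (unipotent groups have no
non-trivial characters). Size S/M, provable now (expand in `s`, char 0). -/
def UFixedIsZFree : Prop :=
  ∀ (n m : ℕ) (f : MvPolynomial (Fin m × Fin m) ℂ),
    (∀ (y z : Fin m × Fin m), IsKept n m y → ¬ IsKept n m z → ∀ s : ℂ,
        linSubst (Fin m × Fin m) ℂ (Matrix.transvection y z s) f = f) →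
    ∀ z : Fin m × Fin m, ¬ IsKept n m z → MvPolynomial.degreeOf z f = 0

/-- **Card `internal-borel-zfree-ladder`, support (SupportTranslation).** Polynomial-side dual of
the same unipotent elements: the common zero set of an `H₀`-stable set of forms is invariant under
adding any multiple of a kept coordinate to a padding coordinate; so off `{ℓ = Y = 0}` it is a
union of full `z`-fibres. Provable now. -/
def SupportTranslation : Prop :=
  ∀ (n m : ℕ) (Q : Set (MvPolynomial (Fin m × Fin m) ℂ)),
    (∀ (y z : Fin m × Fin m), IsKept n m y → ¬ IsKept n m z → ∀ s : ℂ, ∀ f ∈ Q,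
        linSubst (Fin m × Fin m) ℂ (Matrix.transvection y z s) f ∈ Q) →
    ∀ (x : Fin m × Fin m → ℂ), (∀ f ∈ Q, MvPolynomial.eval x f = 0) →
    ∀ (y z : Fin m × Fin m), IsKept n m y → ¬ IsKept n m z → x y ≠ 0 →
    ∀ c : ℂ, ∀ f ∈ Q, MvPolynomial.eval (x + Pi.single z c) f = 0

/-- **Shared helper (PatternSumZeroTop).** The exact form of the "bite" of clause W5 of the crux on
the top pattern: if `D · pp = 0` for the apolarity action `act` of the route file, then for every
`e ≤ m - n` the coefficients of `D` on the pattern monomials `∂_ℓ^e ∂_{i σ i}` (`σ` a permutation of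
the block) sum to zero — the permanent is seen only through these all-ones functionals (for the
padded determinant: signed sums). Provable now (coefficient extraction). -/
def PatternSumZeroTop : Prop :=
  ∀ (n m : ℕ) [NeZero m], n ≤ m →
    let act := fun (D f : MvPolynomial (Fin m × Fin m) ℂ) => ∑ e ∈ D.support, ∑ d ∈ f.support,
      MvPolynomial.monomial (d - e) (MvPolynomial.coeff e D * MvPolynomial.coeff d f *
        ∏ i ∈ e.support, (Nat.descFactorial (d i) (e i) : ℂ))
    ∀ D : MvPolynomial (Fin m × Fin m) ℂ, act D (paddedPerPoly ℂ n m) = 0 →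
    ∀ e ≤ m - n,
      ∑ σ : Equiv.Perm (BlockIdx n m),
        MvPolynomial.coeff
          (Finsupp.single ((0 : Fin m), (0 : Fin m)) e +
            ∑ i : BlockIdx n m, Finsupp.single (((i : Fin m)), ((σ i : BlockIdx n m) : Fin m)) 1) D = 0

/-- **Card `fixed-point-debordering`, first lemma (DeborderWeightedComponent).** Interpolation
de-bordering along a one-parameter subgroup: a weighted-homogeneous component of a polynomial
with an affine determinantal representation of size `r`, for weights bounded by `L`, has an
affine determinantal representation of size polynomial in `deg · L` and `r` (write
`Q(t^w x) = ∑_d t^d Q_d`, `d ≤ deg Q · L`, invert a Vandermonde, add the `deg·L+1` scaled copies as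
branching programs). The exponent `4` is generous. Size M, provable from Valiant/Mahajan–Vinay
facts. -/
def DeborderWeightedComponent : Prop :=
  ∀ {σ : Type} [Fintype σ] [DecidableEq σ] (Q : MvPolynomial σ ℂ) (w : σ → ℕ) (L d r : ℕ),
    (∀ i, w i ≤ L) → HasDetRepr Q r →
    HasDetRepr (MvPolynomial.weightedHomogeneousComponent w d Q) (((Q.totalDegree * L + 1) * (r + 1)) ^ 4)

/-- **Card `fixed-point-debordering`, the transfer target's det-only half (QuantToricFiber),
informal shape.** Every `H₀(n,m)`-stable point `J` of `Z_{det_m}` lying over the padded permanent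
(i.e. a witness of the crux) is a translate of a one-parameter-subgroup limit
`lim_t Ann(u · diag((t+2)^w) · g · det_m)` whose integer weights are bounded by `2^((log₂ m + c)^c)`
— crux `ToricFixedPoints` of the route plus a HEIGHT bound. Stated here only as the existence of
the bound function; the full signature is `ToricFixedPoints` with `w : Fin m × Fin m → ℤ`
replaced by `|w i| ≤ B m`. (Not elaborated as a Prop over the witness data to keep this file
short; see the route decl `ToricFixedPoints`.) -/
def QuantToricShape : Prop :=
  ∃ B : ℕ → ℕ, ∃ c : ℕ, ∀ m, B m ≤ 2 ^ ((Nat.log 2 m + c) ^ c)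

/-- **Card `internal-borel-zfree-ladder`, transfer target's lower-bound half (TorusEquivariantLB),
non-border model statement.** Two-sided-torus-equivariant affine determinantal representations of
`per_n` have size at least `2^n - 1` (Landsberg–Ressayre 2017 Thm 2.8 proves this for the
normaliser `N(T^E)` of the LEFT torus; Grenet's representation is `T^E × T^F`-equivariant of this
size). Here `Γ` = the image in `GL(n²)` of the rank-one torus `Y ↦ diag(a) Y diag(b)`. -/
def TorusEquivariantLB : Prop :=
  ∀ n ≥ 3, ∀ m : ℕ,
    HasEquivariantDetRepr
      (Subgroup.closure
        (Set.range fun ab : (Fin n → ℂˣ) × (Fin n → ℂˣ) =>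
          (⟨Matrix.diagonal fun p : Fin n × Fin n => (ab.1 p.1 : ℂ) * (ab.2 p.2 : ℂ),
            Matrix.diagonal fun p : Fin n × Fin n => ((ab.1 p.1)⁻¹ : ℂ) * ((ab.2 p.2)⁻¹ : ℂ),
            by
              rw [Matrix.diagonal_mul_diagonal, ← Matrix.diagonal_one]
              congr 1; funext p; field_simp,
            by
              rw [Matrix.diagonal_mul_diagonal, ← Matrix.diagonal_one]
              congr 1; funext p; field_simp⟩ : GL (Fin n × Fin n) ℂ)))
      (perPoly (Fin n) ℂ) m → 2 ^ n - 1 ≤ m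

end Summit.ValiantsHypothesis.ValiantsHypothesis.Cruxes.FixedWitnessObstructionQP.Sketch
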